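import Mathlib
import Literature.NumberTheory.LFunctions.Zhang2022.Section6IdoublePrime
import Literature.NumberTheory.LFunctions.Zhang2022.Section6Step15
import Literature.NumberTheory.LFunctions.Zhang2022.Section6PerronStep
import Literature.NumberTheory.LFunctions.Zhang2022.Section6Step6u008
import HarnessLib

/-!
# Zhang (2022), §6: (6.3) with the reflected error term, unconditionally in its own inputs, and the
# additive re-threading of Lemma 6.1

Topic `Literature/NumberTheory/LFunctions/Zhang2022` (Landau–Siegel audit tree; verdict-neutral).
Y. Zhang, *Discrete mean estimates and the Landau–Siegel zero*, arXiv:2211.02515v1 (2022)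
[Zhang2022LandauSiegel] — **an unrefereed manuscript under adjudication**; nothing here asserts or
denies its Theorems 1–2 or anything about Landau–Siegel zeros, and nothing bears on the verdict on
(8.24). Campaign DAG nodes `Z22:(6.3)`, `Z22:(6.1)`, `Z22:Lem6.1.pf` (§6 pp. 31–32, tex L1706–L1781);
GAP-LEDGER rows G-d08-1 / G-d08-2 (the error term of (6.3)/(6.1)/Lemma 6.1 at the reflected point
`1 − s̄`, equal to the printed `E₁(s,ψ)` exactly on `σ = 1/2`).

* `eq63_reflected` — **(6.3) with error `E1main x (1 − s̄) + ε` is now a THEOREM** (no claim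
  hypotheses left): `Section6Statements.step6u015_holds` (L2-t9, `Section6Step15`) fed into
  `eq63_repaired_of_step6u015` (part 4).
* `lemma61_reflected_of_eq61R` — the purely additive last edge of the §6 proof ("It therefore suffices
  to show (6.1)", tex L1714), re-threaded: from (6.1) with the reflected error (`Eq61R`, stated inline;
  it is the target of the remaining §6 proof node "reduced to showing (6.3)" held by L2-t9, whose
  outer-tail estimate is NOT supplied here) and the two theorems `step6u007_holds` (L2-t1),
  `Section6Shift.step6u008_holds` (sz-d26), Lemma 6.1 follows in the (A)-form with error
  `E1main x (1 − s̄) + ε` (`Lemma61AR`, stated inline). For the skeleton owner's re-threading of leaf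
  `h61`.

No new definitions, no facts. What is NOT asserted: (6.1)/`Eq61R`, Lemma 6.1 itself.

## References

* Y. Zhang, arXiv:2211.02515v1 (2022), §6 pp. 30–32, Lemma 6.1, (6.1)–(6.5).
  [cite: Zhang2022LandauSiegel, §6 Lemma 6.1]
-/

noncomputable section

open Complex Real Set MeasureTheory intervalIntegral

namespace Literature.NumberTheory.LFunctions.Zhang2022.Section6Statements

open Skeleton

/-- **`Z22:(6.3)`, reflected error term, PROVED outright**: for some absolute `c > 0`, `C` and all
large `D` (under (A), unused), every `ψ ∈ Ψ` and `s` in the range of Lemma 6.1,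
`‖(1/2πi)∫_{−1−i𝓛²⁰}^{−1+i𝓛²⁰} Z(s+w,ψ)(Σ_{n<T³}ψ̄(n)n^{−(1−s−w)})P₄^wω₁(w)dw/w + Z(s,ψ)N(1−s,ψ̄)‖
≤ C·(E1main x (1 − s̄) + e^{−c𝓛¹⁰})` — `eq63_repaired_of_step6u015` applied to the theorem
`step6u015_holds`. (The printed (6.3) has `E₁(s,ψ)`; see G-d08-2.)
[cite: Zhang2022LandauSiegel, §6 (6.3) p.32, tex L1755] -/
theorem eq63_reflected :
    ∃ c : ℝ, 0 < c ∧ ∃ C : ℝ, ForAllLarge fun D _ χ => AssumptionA D χ → ∀ x : Chr D, ∀ s : ℂ,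
      InRange61 D s →
        ‖lhs63 x s + GammaFactor.Zfac x.ψ s * Nchar D (psiBarFn x) (1 - s)‖
          ≤ C * (E1main x (1 - (starRingEnd ℂ) s) + Real.exp (-c * ell D ^ 10)) :=
  eq63_repaired_of_step6u015 step6u015_holds

/-- **`Z22:Lem6.1.pf` EDGE, re-threaded** ("It therefore suffices to show (6.1)", tex L1714): from
(6.1) with the reflected error term — `Eq61R`: `‖(1/2πi)∫_{(−1)} L(s+w,ψ)P₄^wω₁(w)dw/w + Z(s,ψ)N(1−s,ψ̄)‖
≤ C·(E1main x (1 − s̄) + ε)`, stated inline as the hypothesis — and the theorems `step6u007_holds`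
((4.3)/Perron step) and `Section6Shift.step6u008_holds` (the shift to `u = −1`), Lemma 6.1 in the
(A)-form with error `E1main x (1 − s̄) + ε`:
`‖L(s,ψ) − K(s,ψ) − Z(s,ψ)N(1−s,ψ̄)‖ ≤ C·(E1main x (1 − s̄) + e^{−c𝓛¹⁰})`. Purely additive
(`L − K − ZN = (∫_{(1)} − K) − (∫_{(−1)} + ZN)`, `ε`-constants merged by `min`).
[cite: Zhang2022LandauSiegel, §6 Lemma 6.1 p.31, tex L1706–1718] -/
theorem lemma61_reflected_of_eq61R
    (h61 : ∃ c : ℝ, 0 < c ∧ ∃ C : ℝ, ForAllLarge fun D _ χ => AssumptionA D χ → ∀ x : Chr D,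
      ∀ s : ℂ, InRange61 D s →
        ‖vline (integrandL x s) (-1) + GammaFactor.Zfac x.ψ s * Nchar D (psiBarFn x) (1 - s)‖
          ≤ C * (E1main x (1 - (starRingEnd ℂ) s) + Real.exp (-c * ell D ^ 10))) :
    ∃ c : ℝ, 0 < c ∧ ∃ C : ℝ, ForAllLarge fun D _ χ => AssumptionA D χ → ∀ x : Chr D, ∀ s : ℂ,
      |s.re - 1 / 2| < 2 * alpha D → |s.im - 2 * π * t0 D| < ell1 D + 2 →
        ‖x.ψ.LFunction s - Kchar D (psiFn x) s -
            GammaFactor.Zfac x.ψ s * Nchar D (psiBarFn x) (1 - s)‖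
          ≤ C * (E1main x (1 - (starRingEnd ℂ) s) + Real.exp (-c * ell D ^ 10)) := by
  obtain ⟨c₁, hc₁, C₁, h₁⟩ := step6u007_holds
  obtain ⟨c₃, hc₃, C₃, h₃⟩ := h61
  refine ⟨min c₁ c₃, lt_min hc₁ hc₃, max C₁ 0 + max C₃ 0, ?_⟩
  obtain ⟨D₀, h⟩ := (h₁.and Section6Shift.step6u008_holds).and h₃
  refine ⟨D₀, fun D _ χ hD hq hp hA x s hσ ht => ?_⟩
  obtain ⟨⟨hK', hS'⟩, h61'⟩ := h D χ hD hq hp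
  have hr : InRange61 D s := ⟨hσ, ht⟩
  have e1 := hK' hA x s hr
  have e2 := hS' hA x s hr
  have e3 := h61' hA x s hr
  set E : ℝ := E1main x (1 - (starRingEnd ℂ) s) with hE
  have hE0 : 0 ≤ E := E1main_nonneg x _
  have key : x.ψ.LFunction s - Kchar D (psiFn x) s -
      GammaFactor.Zfac x.ψ s * Nchar D (psiBarFn x) (1 - s) =
      (vline (integrandL x s) 1 - Kchar D (psiFn x) s) -
        (vline (integrandL x s) (-1) + GammaFactor.Zfac x.ψ s * Nchar D (psiBarFn x) (1 - s)) := by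
    rw [e2]; ring
  rw [key]
  have hℓ : 0 ≤ ell D ^ 10 := pow_nonneg (Real.log_natCast_nonneg D) _
  have hε₁ : Real.exp (-c₁ * ell D ^ 10) ≤ Real.exp (-(min c₁ c₃) * ell D ^ 10) :=
    Real.exp_le_exp.mpr (by nlinarith [min_le_left c₁ c₃])
  have hε₃ : Real.exp (-c₃ * ell D ^ 10) ≤ Real.exp (-(min c₁ c₃) * ell D ^ 10) :=
    Real.exp_le_exp.mpr (by nlinarith [min_le_right c₁ c₃])
  have i1 : ‖vline (integrandL x s) 1 - Kchar D (psiFn x) s‖ ≤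
      max C₁ 0 * (E + Real.exp (-(min c₁ c₃) * ell D ^ 10)) :=
    calc _ ≤ C₁ * Real.exp (-c₁ * ell D ^ 10) := e1
      _ ≤ max C₁ 0 * Real.exp (-c₁ * ell D ^ 10) :=
          mul_le_mul_of_nonneg_right (le_max_left _ _) (Real.exp_pos _).le
      _ ≤ max C₁ 0 * (E + Real.exp (-(min c₁ c₃) * ell D ^ 10)) :=
          mul_le_mul_of_nonneg_left (by linarith) (le_max_right _ _)
  have i3 : ‖vline (integrandL x s) (-1) + GammaFactor.Zfac x.ψ s * Nchar D (psiBarFn x) (1 - s)‖ ≤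
      max C₃ 0 * (E + Real.exp (-(min c₁ c₃) * ell D ^ 10)) :=
    calc _ ≤ C₃ * (E + Real.exp (-c₃ * ell D ^ 10)) := e3
      _ ≤ max C₃ 0 * (E + Real.exp (-c₃ * ell D ^ 10)) :=
          mul_le_mul_of_nonneg_right (le_max_left _ _) (add_nonneg hE0 (Real.exp_pos _).le)
      _ ≤ max C₃ 0 * (E + Real.exp (-(min c₁ c₃) * ell D ^ 10)) :=
          mul_le_mul_of_nonneg_left (by linarith) (le_max_right _ _)
  calc _ ≤ ‖vline (integrandL x s) 1 - Kchar D (psiFn x) s‖ +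
        ‖vline (integrandL x s) (-1) + GammaFactor.Zfac x.ψ s * Nchar D (psiBarFn x) (1 - s)‖ :=
        norm_sub_le _ _
    _ ≤ (max C₁ 0 + max C₃ 0) * (E + Real.exp (-(min c₁ c₃) * ell D ^ 10)) := by
        rw [add_mul]; exact add_le_add i1 i3

end Literature.NumberTheory.LFunctions.Zhang2022.Section6Statements
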